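import Summits.Parity.BatemanHorn.Theorems.SelbergDelangeRigidityLSDRealSegmentTailsTwoTopAux
import Literature.NumberTheory.DiophantineApproximation.SPartPolynomialValues
import HarnessLib

/-!
# Route `SelbergDelangeRigidity`, crux `LSDRealSegment` (stmt-Parity-9770), line
# `product-anatomy-subcritical`: preparation of clauses (c), (d) of `stub_tailsTwo` (structure of the top class, assembly)

* `tailsTwo_assembly` (registered helper): the common final assembly of the thin-class clauses — block bounds
  `Σ_{X<n≤2X} w ≤ (E₁ (log x)^e + E₂) X` on `√x < X ≤ x` for an indicator weight `w ≤ y^{Ω_f}`, the a priori bound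
  (clause (a)) on `n ≤ 2√x + 2`, and three numerical side conditions give `Σ_{n ≤ x} w ≤ ε x (log x)^e`;
* the STRUCTURE of the top class: if a prime `p > w` divides `fᵢ(n) < w p` then `roughPart w (fᵢ(n)) = p`, and then the
  tilt factors as `y^{Ω(fᵢ(n))} = y · y^{Ω(smoothPart_P)} · y^{Ω(smoothPart w (roughPart_P))}` — `y` times the engine
  summand with the top weight at `i`;
* a value bound `fᵢ(n) ≤ H n^{deg fᵢ}`.
-/

open Filter Finset Polynomial
open scoped BigOperators Topology Classical

namespace Summit.Parity.BatemanHorn.Cruxes.LSDRealSegment.ProductAnatomySubcritical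

open Literature.NumberTheory.Sieve
open Literature.NumberTheory.DiophantineApproximation
open ArithmeticFunction (cardFactors)
noncomputable section

variable {k : ℕ}

/-! ### The common assembly -/

/-- **tailsTwo_assembly** (registered helper of `stub_tailsTwo`, line `product-anatomy-subcritical`): the common final
assembly of the thin-class clauses.  If `0 ≤ w ≤ y^{Ω_f}`, the a priori bound holds with constant `Ca ≥ 0`, the blocks
`(X, 2X]` with `M ≤ X ≤ x` (`√x < M ≤ √x + 1`, `2M ≤ x`) have `w`-mass `≤ (E₁ (log x)^e + E₂) X` with `E₁ ≤ ε/4`,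
`2E₂ ≤ (ε/4)(log x)^e`, and `Ca (2√x + 2) ≤ (ε/4) x`, then `Σ_{n ≤ x} w(n) ≤ ε x (log x)^e`. [folklore] -/
theorem tailsTwo_assembly : ∀ (k : ℕ) (f : Fin k → ℤ[X]) (y e ε Ca E₁ E₂ : ℝ) (w : ℕ → ℝ) (M x : ℕ), 0 ≤ y → 0 ≤ e →
    0 ≤ Ca → 0 ≤ E₁ → 0 ≤ E₂ → (∀ n, 0 ≤ w n) → (∀ n, w n ≤ y ^ stat f n) →
    (∀ x : ℕ, 2 ≤ x → (∑ n ∈ Finset.range (x + 1), y ^ stat f n) ≤ Ca * ((x : ℝ) * Real.log x ^ e)) →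
    1 ≤ M → (x : ℝ) ^ (1 / 2 : ℝ) < M → (M : ℝ) ≤ (x : ℝ) ^ (1 / 2 : ℝ) + 1 → 2 * M ≤ x → (8 : ℝ) ≤ x →
    (∀ X : ℕ, M ≤ X → X ≤ x → ∑ n ∈ Finset.Ioc X (2 * X), w n ≤ (E₁ * Real.log x ^ e + E₂) * X) →
    E₁ ≤ ε / 4 → 2 * E₂ ≤ ε / 4 * Real.log x ^ e → Ca * (2 * (x : ℝ) ^ (1 / 2 : ℝ) + 2) ≤ ε / 4 * x →
    ∑ n ∈ Finset.Icc 1 x, w n ≤ ε * ((x : ℝ) * Real.log x ^ e) := by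
  intro k f y e ε Ca E₁ E₂ w M x hy he hCa0 hE₁0 hE₂0 hw0 hwle hCa hM1 hMsqrt hMle h2Mx hx8 hblk hE₁ hE₂ hCa'
  have hxpos : (0 : ℝ) < x := by linarith
  have hlogx : 0 < Real.log x := Real.log_pos (by linarith)
  have hL0 : 0 ≤ Real.log x ^ e := Real.rpow_nonneg hlogx.le e
  have hasm := sum_Icc_le_of_blocks hw0 (by positivity : 0 ≤ E₁ * Real.log x ^ e + E₂) hM1 hblk x le_rfl
  refine hasm.trans ?_
  have hshort : ∑ n ∈ Finset.Icc 1 (2 * M), w n ≤ Ca * ((2 * (x : ℝ) ^ (1 / 2 : ℝ) + 2) * Real.log x ^ e) := by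
    have h2M : 2 ≤ 2 * M := by omega
    calc ∑ n ∈ Finset.Icc 1 (2 * M), w n ≤ ∑ n ∈ Finset.Icc 1 (2 * M), y ^ stat f n := Finset.sum_le_sum fun n _ => hwle n
      _ ≤ ∑ n ∈ Finset.range (2 * M + 1), y ^ stat f n :=
          Finset.sum_le_sum_of_subset_of_nonneg (fun n hn => by rw [Finset.mem_Icc] at hn; rw [Finset.mem_range]; omega)
            fun n _ _ => by positivity
      _ ≤ Ca * (((2 * M : ℕ) : ℝ) * Real.log ((2 * M : ℕ) : ℝ) ^ e) := hCa (2 * M) h2M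
      _ ≤ Ca * ((2 * (x : ℝ) ^ (1 / 2 : ℝ) + 2) * Real.log x ^ e) := by
          refine mul_le_mul_of_nonneg_left (mul_le_mul ?_ ?_ (by positivity) (by positivity)) hCa0
          · push_cast; linarith
          · exact Real.rpow_le_rpow (Real.log_natCast_nonneg _) (Real.log_le_log (by positivity) (by exact_mod_cast h2Mx)) he
  have hfin1 : Ca * ((2 * (x : ℝ) ^ (1 / 2 : ℝ) + 2) * Real.log x ^ e) ≤ ε / 4 * ((x : ℝ) * Real.log x ^ e) := by
    calc Ca * ((2 * (x : ℝ) ^ (1 / 2 : ℝ) + 2) * Real.log x ^ e) = Ca * (2 * (x : ℝ) ^ (1 / 2 : ℝ) + 2) * Real.log x ^ e := by ring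
      _ ≤ ε / 4 * x * Real.log x ^ e := mul_le_mul_of_nonneg_right hCa' hL0
      _ = _ := by ring
  calc (∑ n ∈ Finset.Icc 1 (2 * M), w n) + 2 * (E₁ * Real.log x ^ e + E₂) * x
      = (∑ n ∈ Finset.Icc 1 (2 * M), w n) + 2 * E₁ * ((x : ℝ) * Real.log x ^ e) + (2 * E₂) * x := by ring
    _ ≤ ε / 4 * ((x : ℝ) * Real.log x ^ e) + 2 * (ε / 4) * ((x : ℝ) * Real.log x ^ e) + (ε / 4 * Real.log x ^ e) * x :=
        add_le_add (add_le_add (hshort.trans hfin1) (by nlinarith [mul_nonneg hxpos.le hL0])) (mul_le_mul_of_nonneg_right hE₂ hxpos.le)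
    _ = ε * ((x : ℝ) * Real.log x ^ e) := by ring

/-! ### Values of one member -/

/-- `fᵢ(n) ≤ H n^{deg fᵢ}` for `n ≥ 1`, one `H ≥ 1` for all members. [folklore] -/
theorem val_le_height_pow (f : Fin k → ℤ[X]) : ∃ Hc : ℕ, 1 ≤ Hc ∧ ∀ (i : Fin k) (n : ℕ), 1 ≤ n →
    (val f i n : ℝ) ≤ Hc * (n : ℝ) ^ (f i).natDegree := by
  set Hc : ℕ := 1 + ∑ i, ∑ j ∈ Finset.range ((f i).natDegree + 1), ((f i).coeff j).natAbs with hHc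
  refine ⟨Hc, by omega, fun i n hn => ?_⟩
  have h := abs_eval_le_height_mul_pow (f i) (n : ℤ)
  have hmax : max 1 |((n : ℤ) : ℝ)| = n := by
    rw [Int.cast_natCast, abs_of_nonneg (Nat.cast_nonneg n), max_eq_right (by exact_mod_cast hn)]
  rw [hmax] at h
  have hHi : (∑ j ∈ Finset.range ((f i).natDegree + 1), |((f i).coeff j : ℝ)|) ≤ Hc := by
    rw [hHc]; push_cast
    have e1 : (∑ j ∈ Finset.range ((f i).natDegree + 1), |((f i).coeff j : ℝ)|) =
        ∑ j ∈ Finset.range ((f i).natDegree + 1), ((((f i).coeff j).natAbs : ℕ) : ℝ) :=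
      Finset.sum_congr rfl fun j _ => by rw [Nat.cast_natAbs, Int.cast_abs]
    rw [e1]
    have h0 : ∀ i', 0 ≤ ∑ j ∈ Finset.range ((f i').natDegree + 1), ((((f i').coeff j).natAbs : ℕ) : ℝ) :=
      fun i' => Finset.sum_nonneg fun j _ => Nat.cast_nonneg _
    linarith [Finset.single_le_sum (fun i' _ => h0 i') (Finset.mem_univ i)]
  rcases le_or_gt 1 ((f i).eval (n : ℤ)).toNat with h1 | h1
  · have hv : (val f i n : ℝ) ≤ |(((f i).eval (n : ℤ) : ℤ) : ℝ)| := by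
      rw [val, max_eq_left h1]
      have : (((f i).eval (n : ℤ)).toNat : ℤ) ≤ |(f i).eval (n : ℤ)| := by
        rw [Int.toNat_of_nonneg (by omega)]; exact le_abs_self _
      exact_mod_cast this
    exact hv.trans (h.trans (mul_le_mul_of_nonneg_right hHi (by positivity)))
  · rw [val, max_eq_right (by omega), Nat.cast_one]
    have h2 : (1 : ℝ) ≤ Hc := by exact_mod_cast (show 1 ≤ Hc by omega)
    have h3 : (1 : ℝ) ≤ (n : ℝ) ^ (f i).natDegree := one_le_pow₀ (by exact_mod_cast hn)
    nlinarith

/-! ### The structure of the top class -/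

/-- **Structure of the top class**: if a prime `p > w` divides `v` and `v < w p` then `roughPart w v = p`
(the cofactor `v/p < w` is `w`-smooth). [folklore] -/
theorem roughPart_eq_of_prime_dvd {w : ℝ} {v p : ℕ} (hp : p ∈ v.primeFactors) (hwp : w < (p : ℝ))
    (hv : (v : ℝ) < w * p) : roughPart w v = p := by
  have hp' := Nat.prime_of_mem_primeFactors hp
  have hv0 : v ≠ 0 := (Nat.mem_primeFactors.mp hp).2.2
  obtain ⟨m, hm⟩ := Nat.dvd_of_mem_primeFactors hp
  have hm0 : m ≠ 0 := fun h => hv0 (by rw [hm, h, mul_zero])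
  have hp0 : (0 : ℝ) < p := by exact_mod_cast hp'.pos
  have hmw : (m : ℝ) < w := by
    have : (v : ℝ) = p * m := by rw [hm]; push_cast; ring
    rw [this] at hv
    nlinarith
  have h1 : roughPart w p = p := roughPart_eq_self_of_lt hp'.ne_zero fun q hq => by
    rw [hp'.primeFactors, Finset.mem_singleton] at hq
    rw [hq]; exact hwp
  have h2 : roughPart w m = 1 := roughPart_eq_one_of_le hm0 fun q hq => by
    have : (q : ℝ) ≤ m := by exact_mod_cast Nat.le_of_mem_primeFactors hq
    linarith
  rw [hm, roughPart_mul w hp'.ne_zero hm0, h1, h2, mul_one]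

/-- **The tilt on the top class** (`P ≤ w`, `roughPart w (fᵢ(n))` a prime): `y^{Ω_f(n)}` is `y` times the engine summand
with the top weight `y^{Ω(smoothPart w r)} 1[Ω(roughPart w r) ≤ 1]` (`r = roughPart P ·`) at `i` and the plain peeled
weights elsewhere. [folklore] -/
theorem pow_stat_eq_topSummand (f : Fin k → ℤ[X]) {y w : ℝ} {P : ℕ} (hPw : (P : ℝ) ≤ w) (n : ℕ) (i : Fin k)
    (hprime : (roughPart w (val f i n)).Prime) :
    y ^ stat f n = y * ∏ j, (y ^ cardFactors (smoothPart (P : ℝ) (val f j n)) *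
      (if j = i then y ^ cardFactors (smoothPart w (roughPart (P : ℝ) (val f j n))) *
        (if cardFactors (roughPart w (roughPart (P : ℝ) (val f j n))) ≤ 1 then (1 : ℝ) else 0)
       else y ^ cardFactors (roughPart (P : ℝ) (val f j n)))) := by
  have hL : y ^ stat f n = (y ^ cardFactors (smoothPart (P : ℝ) (val f i n)) * y ^ cardFactors (roughPart (P : ℝ) (val f i n))) *
      ∏ j ∈ Finset.univ.erase i, (y ^ cardFactors (smoothPart (P : ℝ) (val f j n)) * y ^ cardFactors (roughPart (P : ℝ) (val f j n))) := by
    rw [pow_stat_eq_prod_smooth_rough f y P n, Finset.mul_prod_erase Finset.univ (fun j => y ^ cardFactors (smoothPart (P : ℝ) (val f j n)) * y ^ cardFactors (roughPart (P : ℝ) (val f j n))) (Finset.mem_univ i)]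
  have hR : ∏ j, (y ^ cardFactors (smoothPart (P : ℝ) (val f j n)) * (if j = i then y ^ cardFactors (smoothPart w (roughPart (P : ℝ) (val f j n))) *
        (if cardFactors (roughPart w (roughPart (P : ℝ) (val f j n))) ≤ 1 then (1 : ℝ) else 0)
       else y ^ cardFactors (roughPart (P : ℝ) (val f j n)))) = (y ^ cardFactors (smoothPart (P : ℝ) (val f i n)) * (y ^ cardFactors (smoothPart w (roughPart (P : ℝ) (val f i n))) *
        (if cardFactors (roughPart w (roughPart (P : ℝ) (val f i n))) ≤ 1 then (1 : ℝ) else 0))) * ∏ j ∈ Finset.univ.erase i, (y ^ cardFactors (smoothPart (P : ℝ) (val f j n)) * y ^ cardFactors (roughPart (P : ℝ) (val f j n))) := by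
    rw [← Finset.mul_prod_erase Finset.univ _ (Finset.mem_univ i), if_pos rfl]
    congr 1
    exact Finset.prod_congr rfl fun j hj => by rw [if_neg (Finset.ne_of_mem_erase hj)]
  rw [hL, hR]
  -- the factor at `i`: `y^{Ω(rp)} = y · y^{Ω(smoothPart w rp)} · 1`
  set r := roughPart (P : ℝ) (val f i n) with hr
  have hr0 : r ≠ 0 := roughPart_ne_zero _ _
  have hrw : roughPart w r = roughPart w (val f i n) := roughPart_roughPart_of_le hPw _
  have hΩ1 : cardFactors (roughPart w r) = 1 := by
    rw [hrw]; exact ArithmeticFunction.cardFactors_apply_prime hprime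
  have hkey : y ^ cardFactors r = y * (y ^ cardFactors (smoothPart w r) * (if cardFactors (roughPart w r) ≤ 1 then (1 : ℝ) else 0)) := by
    rw [if_pos (by rw [hΩ1]), mul_one, pow_cardFactors_eq_smooth_mul_rough y w hr0, hΩ1, pow_one]; ring
  rw [hkey]; ring

end

end Summit.Parity.BatemanHorn.Cruxes.LSDRealSegment.ProductAnatomySubcritical
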